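import Summits.AtomisticToContinuum.HydrodynamicLimit.Theorems.CollisionIsometryCLTCollisionalTransferLocalityLawsAssembly
import HarnessLib

/-!
# Split of the crux `CollisionalTransferLocality` (stmt-AtomisticToContinuum-9518) into five named sub-statements — the glue theorem

Crux-strategist support file (`--supports stmt-AtomisticToContinuum-9518`) for the route
`StiffCollisionalRelaxation` (the crux is shared verbatim with `CollisionIsometryCLT`, `Disproof.shared_verbatim`).
Eleven line leads of the line `hemisphere-affine-slaving` (skeleton `Cruxes/CollisionalTransferLocality/Lines/hemisphere_affine_slaving.lean`,
v19.4; ≈ 94 landed `Theorems/CollisionIsometryCLTCollisionalTransferLocality*` files) reduced the FILED `∀ t > 0` crux to named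
statements: `collisionalTransferLocality_of_laws` (…LawsAssembly, seat c9) proves it from the route crux `FastMomentRelaxation`
(stmt-9522), the item `InformationPercolationEngine.CollisionMomentBound` (stmt-15144), the two mesoscale ENGINE LAWS
`CollisionalStressLaw` [Kσ] / `CollisionalEnergyFluxLaw` [Kq] (…DefsD; the Boltzmann–Enskog marked Campbell law along the
non-equilibrium flow, momentum resp. energy channel) and the `∀ t` mesoscale dilute ceiling [S'] (registered stub
`stub_ceilingAllTimes`; false modulo `PersistentJam`, `ceilingAllTimes_false_of_persistentJam`).

This file is the GLUE of the planner-side decomposition (`ledger route edit … --split CollisionalTransferLocality --glue-by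
collisionalTransferLocality_of_subs`): the same composition with every hypothesis stated in ROUTE VOCABULARY (only `Mathlib` /
`Literature` names and `let`-telescopes — the texts filed as the five children), and with the kinetic input SEPARATED from 9522:
the crux consumes `FastMomentRelaxation` only through the landed [C]° `stub_weightedKineticRelaxationDilute` (the `(Z−1)`-weighted
kinetic corrections `Kfun → 0` on the dilute event), so the fifth child `WeightedKineticCorrectionsVanishInline` states exactly that
and `weightedKineticCorrectionsVanishInline_of_fastMomentRelaxation` certifies it is a COROLLARY of 9522 (via [C]°, the all-times
energy cap [E] `stub_energyAllTimes` and the linear compressibility bound [Z] `stub_hsCompressibility_linear`, all landed) —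
9522 is a top-level crux of the same route and cannot itself be a child of 9518.

Children (texts = the bodies of the `def`s named here; the first is the body of the existing item 15144):
1. `Summit.AtomisticToContinuum.HydrodynamicLimit.Theses.InformationPercolationEngine.CollisionMomentBound` (stmt-15144, by name) ⇒ [V]
   `virialBounded_of_collisionMomentBound`;
2. `CollisionalStressLawInline` (…DefsD) [Kσ] — `collisionalStressLaw_iff_inline`;
3. `CollisionalEnergyFluxLawInline` (…DefsD) [Kq] — `collisionalEnergyFluxLaw_iff_inline`;
4. `MesoscaleDiluteCeilingAllTimesInline` (here) [S'] — `ceilingAllTimes_of_inline` / `inline_of_ceilingAllTimes`;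
5. `WeightedKineticCorrectionsVanishInline` (here) [KC] — `relaxC_of_inline`; certificate `…_of_fastMomentRelaxation`.
Glue: `collisionalTransferLocality_of_subs : (1) → (2) → (3) → (4) → (5) → StiffCollisionalRelaxation.CollisionalTransferLocality`
(proof = `collisionalTransferLocality_of_laws` with `hF`/[C]° replaced by child 5; landed glue only: `conclusion_of_channels` p139580,
[Z] p117576, `virialBounded_of_collisionMomentBound` p115360, `DiluteAt.mono`, `conclusionAtFlow_iff`). Nothing is asserted: every
`def … : Prop` is an item text, every theorem is unconditional.
-/

namespace Summit.AtomisticToContinuum.HydrodynamicLimit.Theorems.HemisphereAffineSlaving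

open scoped BigOperators Topology Manifold Classical MeasureTheory ProbabilityTheory Matrix InnerProductSpace ComplexConjugate ContinuousMap ENNReal
open Filter Set Function TopologicalSpace MeasureTheory

noncomputable section

open Literature.MathematicalPhysics.KineticTheory (T3 V3)

namespace Split

/-! ## The two new child texts (route vocabulary) -/

/-- **[S'] THE `∀ t` MESOSCALE DILUTE CEILING** (child 4; registered stub `stub_ceilingAllTimes` of the skeleton with `NiceProfiles`,
`AdmissibleKernel`, `DiluteAt` unfolded). For every level `η₁ > 0` and all continuous positive profiles there is `σ₀ > 0` such that for
`0 < σ < σ₀`, EVERY flow family, EVERY horizon `t > 0` and every admissible mesoscale kernel family, with local-Gibbs probability `→ 1` no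
block is denser than `η₁/σ³` at any time `s ≤ t`. Needed ONLY because the filed crux is `∀ t > 0`; false modulo `PersistentJam`
(`ceilingAllTimes_false_of_persistentJam`, Theorems/CollisionalTransferLocality/Negative); pre-shock it is `GermanoSplitLES.KineticRangeControl`
(stmt-9201) by name (`stub_diluteBlocks_of_kineticRangeControl`). DEFINED here, never assumed. -/
def MesoscaleDiluteCeilingAllTimesInline : Prop :=
  ∀ η₁ : ℝ, 0 < η₁ → ∀ (a₀ θ₀ : (UnitAddTorus (Fin 3)) → ℝ) (u₀ : (UnitAddTorus (Fin 3)) → (EuclideanSpace ℝ (Fin 3))), Continuous a₀ → Continuous θ₀ → Continuous u₀ → (∀ x, 0 < a₀ x) → (∀ x, 0 < θ₀ x) → ∃ σ₀ : ℝ, 0 < σ₀ ∧ ∀ σ : ℝ, 0 < σ → σ < σ₀ → ∀ Φ : (N : ℕ) → Literature.Analysis.FluidPDE.HardSphereFlow (Literature.Analysis.FluidPDE.Torus.geometry (Fin 3)) (Literature.MathematicalPhysics.KineticTheory.hsDiameter σ N) (N + 1), ∀ t : ℝ, 0 < t → ∀ (γ C : ℝ) (φ : ℕ → (UnitAddTorus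 (Fin 3)) → ℝ), 0 < γ → γ ≤ 1 / 15 → ((∀ N, Literature.Analysis.FunctionSpaces.Torus.IsSmooth (φ N)) ∧ (∀ N y, 0 ≤ φ N y) ∧ (∀ N, ∫ y, φ N y = 1) ∧ (∀ (N : ℕ) y, ((N : ℝ) + 1) ^ (-γ) ≤ Literature.Analysis.FluidPDE.Torus.euclidDist y 0 → φ N y = 0) ∧ (∀ (N : ℕ) y, φ N y ≤ C * ((N : ℝ) + 1) ^ (3 * γ)) ∧ (∀ (N : ℕ) y, ‖Literature.Analysis.FunctionSpaces.Torus.gradient (φ N) y‖ ≤ C * ((N : ℝ) + 1) ^ (4 * γ))) → Tendsto (fun N : ℕ => Literature.MathematicalPhysics.KineticTheory.localGibbsLaw σ a₀ u₀ θ₀ N (Φ N) {z | ∃ s ∈ Icc 0 t, ∃ x : (UnitAddTorus (Fin 3)), η₁ < Literature.MathematicalPhysics.KineticTheory.empiricalDensityField ((Φ N).flow s z) (fun y => φ N (y - x)) * σ ^ 3}) atTop (𝓝 0)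

/-- **[KC] THE `(Z−1)`-WEIGHTED KINETIC CORRECTIONS VANISH ON THE DILUTE EVENT** (child 5; the line's `RelaxC` for all smooth tests,
with `Kfun`, `kinW`, `Dst`, `qfl`, `pcoll`, the block fields and `DiluteAt` unfolded). For all continuous positive profiles there are `σ₀ > 0`
and a dilute level `η₁ > 0` such that for `0 < σ < σ₀`, every flow family, every `t > 0` and every admissible kernel family: IF w.h.p. no
block is denser than `η₁/σ³` on `[0, t]`, THEN for all space–time smooth tests `ψ`, `χ` on `[0, t]`, uniformly in `τ ≤ t`, the weak
kinetic-correction functional `K_N(τ) = ∫₀^τ∫ (Z(ρ̄σ³) − 1)[(2/5)(D̄:∇ψ + (D̄ū)·∇χ) + (3/5) q̄·∇χ] dx ds → 0` in local-Gibbs probability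
(`D̄` the block traceless central kinetic stress, `q̄` the block kinetic heat flux, as in 9522). It is what the crux consumes of the
kinetic closure 9522 `FastMomentRelaxation` (COROLLARY of it: `weightedKineticCorrectionsVanishInline_of_fastMomentRelaxation`), and
strictly weaker as typed (`(Z−1) = O(σ³ρ̄)`-weighted, tested, signed). DEFINED here, never assumed. -/
def WeightedKineticCorrectionsVanishInline : Prop :=
  ∀ (a₀ θ₀ : (UnitAddTorus (Fin 3)) → ℝ) (u₀ : (UnitAddTorus (Fin 3)) → (EuclideanSpace ℝ (Fin 3))), Continuous a₀ → Continuous θ₀ → Continuous u₀ → (∀ x, 0 < a₀ x) → (∀ x, 0 < θ₀ x) → ∃ σ₀ : ℝ, 0 < σ₀ ∧ ∃ η₁ : ℝ, 0 < η₁ ∧ ∀ σ : ℝ, 0 < σ → σ < σ₀ → ∀ Φ : (N : ℕ) → Literature.Analysis.FluidPDE.HardSphereFlow (Literature.Analysis.FluidPDE.Torus.geometry (Fin 3)) (Literature.MathematicalPhysics.KineticTheory.hsDiameter σ N) (N + 1), ∀ t : ℝ, 0 < t → ∀ (γ C : ℝ) (φ : ℕ → (UnitAddTorus (Fin 3)) →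 ℝ), 0 < γ → γ ≤ 1 / 15 → ((∀ N, Literature.Analysis.FunctionSpaces.Torus.IsSmooth (φ N)) ∧ (∀ N y, 0 ≤ φ N y) ∧ (∀ N, ∫ y, φ N y = 1) ∧ (∀ (N : ℕ) y, ((N : ℝ) + 1) ^ (-γ) ≤ Literature.Analysis.FluidPDE.Torus.euclidDist y 0 → φ N y = 0) ∧ (∀ (N : ℕ) y, φ N y ≤ C * ((N : ℝ) + 1) ^ (3 * γ)) ∧ (∀ (N : ℕ) y, ‖Literature.Analysis.FunctionSpaces.Torus.gradient (φ N) y‖ ≤ C * ((N : ℝ) + 1) ^ (4 * γ))) → let ρb := fun (N : ℕ) (z : Literature.Analysis.FluidPDE.Config (N + 1) (Fin 3) (UnitAddTorus (Fin 3))) (x : (UnitAddTorus (Fin 3))) => Literature.MathematicalPhysics.KineticTheory.empiricalDensityField z (fun y => φ N (y - x)); let mb := fun (N : ℕ) (z : Literature.Analysis.FluidPDE.Config (N + 1) (Fin 3) (UnitAddTorus (Fin 3))) (x : (UnitAddTorus (Fin 3))) => Literature.MathematicalPhysics.KineticTheory.empiricalMomentumField z (fun y => φ N (y - x)); let Eb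 := fun (N : ℕ) (z : Literature.Analysis.FluidPDE.Config (N + 1) (Fin 3) (UnitAddTorus (Fin 3))) (x : (UnitAddTorus (Fin 3))) => Literature.MathematicalPhysics.KineticTheory.empiricalEnergyField z (fun y => φ N (y - x)); let ub := fun (N : ℕ) (z : Literature.Analysis.FluidPDE.Config (N + 1) (Fin 3) (UnitAddTorus (Fin 3))) (x : (UnitAddTorus (Fin 3))) => (ρb N z x)⁻¹ • mb N z x; let θb := fun (N : ℕ) (z : Literature.Analysis.FluidPDE.Config (N + 1) (Fin 3) (UnitAddTorus (Fin 3))) (x : (UnitAddTorus (Fin 3))) => 2 / 3 * (Eb N z x / ρb N z x - ‖mb N z x‖ ^ 2 / (2 * ρb N z x ^ 2)); Tendsto (fun N : ℕ => Literature.MathematicalPhysics.KineticTheory.localGibbsLaw σ a₀ u₀ θ₀ N (Φ N) {z | ∃ s ∈ Icc 0 t, ∃ x : (UnitAddTorus (Fin 3)), η₁ < ρb N ((Φ N).flow s z) x * σ ^ 3}) atTop (𝓝 0) → ∀ (ψ : ℝ → (UnitAddTorus (Fin 3)) → (EuclideanSpace ℝ (Fin 3))) (χ : ℝ → (UnitAddTorus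 (Fin 3)) → ℝ), Literature.Analysis.FunctionSpaces.Torus.IsSmoothSpaceTimeOn (Icc 0 t) ψ → Literature.Analysis.FunctionSpaces.Torus.IsSmoothSpaceTimeOn (Icc 0 t) χ → let D := fun (N : ℕ) (z : Literature.Analysis.FluidPDE.Config (N + 1) (Fin 3) (UnitAddTorus (Fin 3))) (x : (UnitAddTorus (Fin 3))) (j k : Fin 3) => (∫ y, φ N (y.1 - x) * ((y.2 j - ub N z x j) * (y.2 k - ub N z x k)) ∂(Literature.Analysis.FluidPDE.empiricalMeasure z)) - (if j = k then (∑ l : Fin 3, ∫ y, φ N (y.1 - x) * (y.2 l - ub N z x l) ^ 2 ∂(Literature.Analysis.FluidPDE.empiricalMeasure z)) / 3 else 0); let q := fun (N : ℕ) (z : Literature.Analysis.FluidPDE.Config (N + 1) (Fin 3) (UnitAddTorus (Fin 3))) (x : (UnitAddTorus (Fin 3))) => ∫ y, (φ N (y.1 - x) * ‖y.2 - ub N z x‖ ^ 2 / 2) • (y.2 - ub N z x) ∂(Literature.Analysis.FluidPDE.empiricalMeasure z); let pc := fun (r th : ℝ) => Literature.MathematicalPhysics.KineticTheory.hsPressure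 σ r th - r * th; let Kc := fun (N : ℕ) (z : Literature.Analysis.FluidPDE.Config (N + 1) (Fin 3) (UnitAddTorus (Fin 3))) (τ : ℝ) => ∫ s in Icc 0 τ, ∫ x, (2 / 5 * ((∑ a, ∑ b, D N ((Φ N).flow s z) x a b * Literature.Analysis.FunctionSpaces.Torus.gradient (fun y => ψ s y a) x b) + (∑ a, ∑ b, D N ((Φ N).flow s z) x a b * ub N ((Φ N).flow s z) x b * Literature.Analysis.FunctionSpaces.Torus.gradient (χ s) x a)) / (ρb N ((Φ N).flow s z) x * θb N ((Φ N).flow s z) x) + 3 / 5 * (∑ a, q N ((Φ N).flow s z) x a * Literature.Analysis.FunctionSpaces.Torus.gradient (χ s) x a) / (ρb N ((Φ N).flow s z) x * θb N ((Φ N).flow s z) x)) * pc (ρb N ((Φ N).flow s z) x) (θb N ((Φ N).flow s z) x); ∀ δ : ℝ, 0 < δ → Tendsto (fun N : ℕ => Literature.MathematicalPhysics.KineticTheory.localGibbsLaw σ a₀ u₀ θ₀ N (Φ N) {z | ∃ τ ∈ Icc 0 t, δ < |Kc N z τ|}) atTop (𝓝 0)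

/-! ## Bridges to the line's vocabulary (definitional unfolding) -/

/-- Child 4 ⇒ the registered stub [S'] (line vocabulary). -/
theorem ceilingAllTimes_of_inline (h : MesoscaleDiluteCeilingAllTimesInline) :
    ∀ η₁ : ℝ, 0 < η₁ → ∀ (a₀ θ₀ : T3 → ℝ) (u₀ : T3 → V3), NiceProfiles a₀ θ₀ u₀ → ∃ σ₀ : ℝ, 0 < σ₀ ∧ ∀ σ : ℝ, 0 < σ → σ < σ₀ →
      ∀ (Φ : Flows σ) (t : ℝ), 0 < t → ∀ (γ C : ℝ) (φ : ℕ → T3 → ℝ), 0 < γ → γ ≤ 1 / 15 → AdmissibleKernel γ C φ →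
        DiluteAt σ a₀ θ₀ u₀ Φ t φ η₁ := by
  intro η₁ hη₁ a₀ θ₀ u₀ hP
  obtain ⟨σ₀, hσ₀, H⟩ := h η₁ hη₁ a₀ θ₀ u₀ hP.1 hP.2.1 hP.2.2.1 hP.2.2.2.1 hP.2.2.2.2
  exact ⟨σ₀, hσ₀, fun σ hσ hlt Φ t ht γ C φ hγ hγ' hadm => H σ hσ hlt Φ t ht γ C φ hγ hγ' hadm⟩

/-- The registered stub [S'] ⇒ child 4 (so the child IS the stub, restated in route vocabulary). -/
theorem inline_of_ceilingAllTimes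
    (h : ∀ η₁ : ℝ, 0 < η₁ → ∀ (a₀ θ₀ : T3 → ℝ) (u₀ : T3 → V3), NiceProfiles a₀ θ₀ u₀ → ∃ σ₀ : ℝ, 0 < σ₀ ∧ ∀ σ : ℝ, 0 < σ → σ < σ₀ →
      ∀ (Φ : Flows σ) (t : ℝ), 0 < t → ∀ (γ C : ℝ) (φ : ℕ → T3 → ℝ), 0 < γ → γ ≤ 1 / 15 → AdmissibleKernel γ C φ →
        DiluteAt σ a₀ θ₀ u₀ Φ t φ η₁) :
    MesoscaleDiluteCeilingAllTimesInline := by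
  intro η₁ hη₁ a₀ θ₀ u₀ ha hθ hu ha0 hθ0
  obtain ⟨σ₀, hσ₀, H⟩ := h η₁ hη₁ a₀ θ₀ u₀ ⟨ha, hθ, hu, ha0, hθ0⟩
  exact ⟨σ₀, hσ₀, fun σ hσ hlt Φ t ht γ C φ hγ hγ' hadm => H σ hσ hlt Φ t ht γ C φ hγ hγ' hadm⟩

/-- Child 5 ⇒ the line's `RelaxC` for all smooth tests on the dilute event (line vocabulary). -/
theorem relaxC_of_inline (h : WeightedKineticCorrectionsVanishInline) :
    ∀ (a₀ θ₀ : T3 → ℝ) (u₀ : T3 → V3), NiceProfiles a₀ θ₀ u₀ → ∃ σ₀ : ℝ, 0 < σ₀ ∧ ∃ η₁ : ℝ, 0 < η₁ ∧ ∀ σ : ℝ, 0 < σ → σ < σ₀ →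
      ∀ (Φ : Flows σ) (t : ℝ), 0 < t → ∀ (γ C : ℝ) (φ : ℕ → T3 → ℝ), 0 < γ → γ ≤ 1 / 15 → AdmissibleKernel γ C φ →
        DiluteAt σ a₀ θ₀ u₀ Φ t φ η₁ → ∀ (ψ : ℝ → T3 → V3) (χ : ℝ → T3 → ℝ),
          Literature.Analysis.FunctionSpaces.Torus.IsSmoothSpaceTimeOn (Icc 0 t) ψ →
          Literature.Analysis.FunctionSpaces.Torus.IsSmoothSpaceTimeOn (Icc 0 t) χ → RelaxC σ a₀ θ₀ u₀ Φ φ t ψ χ := by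
  intro a₀ θ₀ u₀ hP
  obtain ⟨σ₀, hσ₀, η₁, hη₁, H⟩ := h a₀ θ₀ u₀ hP.1 hP.2.1 hP.2.2.1 hP.2.2.2.1 hP.2.2.2.2
  refine ⟨σ₀, hσ₀, η₁, hη₁, ?_⟩
  intro σ hσ hlt Φ t ht γ C φ hγ hγ' hadm hD ψ χ hψ hχ
  exact H σ hσ hlt Φ t ht γ C φ hγ hγ' hadm hD ψ χ hψ hχ

/-- The line's `RelaxC` statement ⇒ child 5 (so the child IS that statement, in route vocabulary). -/
theorem inline_of_relaxC
    (h : ∀ (a₀ θ₀ : T3 → ℝ) (u₀ : T3 → V3), NiceProfiles a₀ θ₀ u₀ → ∃ σ₀ : ℝ, 0 < σ₀ ∧ ∃ η₁ : ℝ, 0 < η₁ ∧ ∀ σ : ℝ, 0 < σ → σ < σ₀ →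
      ∀ (Φ : Flows σ) (t : ℝ), 0 < t → ∀ (γ C : ℝ) (φ : ℕ → T3 → ℝ), 0 < γ → γ ≤ 1 / 15 → AdmissibleKernel γ C φ →
        DiluteAt σ a₀ θ₀ u₀ Φ t φ η₁ → ∀ (ψ : ℝ → T3 → V3) (χ : ℝ → T3 → ℝ),
          Literature.Analysis.FunctionSpaces.Torus.IsSmoothSpaceTimeOn (Icc 0 t) ψ →
          Literature.Analysis.FunctionSpaces.Torus.IsSmoothSpaceTimeOn (Icc 0 t) χ → RelaxC σ a₀ θ₀ u₀ Φ φ t ψ χ) :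
    WeightedKineticCorrectionsVanishInline := by
  intro a₀ θ₀ u₀ ha hθ hu ha0 hθ0
  obtain ⟨σ₀, hσ₀, η₁, hη₁, H⟩ := h a₀ θ₀ u₀ ⟨ha, hθ, hu, ha0, hθ0⟩
  refine ⟨σ₀, hσ₀, η₁, hη₁, ?_⟩
  intro σ hσ hlt Φ t ht γ C φ hγ hγ' hadm ρb mb Eb ub θb hD ψ χ hψ hχ
  exact H σ hσ hlt Φ t ht γ C φ hγ hγ' hadm hD ψ χ hψ hχ

/-! ## Certificate: child 5 is a corollary of the route crux 9522 `FastMomentRelaxation` -/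

/-- **[KC] ⟸ 9522.** From `FastMomentRelaxation` (the `∀ t` kinetic closure `∫₀ᵗ∫ ΣD̄² + |q̄|² → 0` in probability), the landed
all-times energy cap [E] `stub_energyAllTimes`, the landed linear compressibility bound [Z] `stub_hsCompressibility_linear` (answering
`η₁ := η_Z`) and the landed [C]° `stub_weightedKineticRelaxationDilute`: `σ₀ := min σ_9522 (1/2)`. -/
theorem weightedKineticCorrectionsVanishInline_of_fastMomentRelaxation
    (hF : Summit.AtomisticToContinuum.HydrodynamicLimit.Theses.StiffCollisionalRelaxation.FastMomentRelaxation) :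
    WeightedKineticCorrectionsVanishInline := by
  apply inline_of_relaxC
  intro a₀ θ₀ u₀ hP
  obtain ⟨ηZ, hηZ, K, hK0, hZK⟩ :=
    Summit.AtomisticToContinuum.HydrodynamicLimit.Theorems.HemisphereAffineSlaving.stub_hsCompressibility_linear
  obtain ⟨σF, hσF, HF⟩ := hF a₀ θ₀ u₀ hP.1 hP.2.1 hP.2.2.1 hP.2.2.2.1 hP.2.2.2.2
  have HC := Summit.AtomisticToContinuum.HydrodynamicLimit.Theorems.HemisphereAffineSlaving.stub_weightedKineticRelaxationDilute
    ηZ K hηZ hK0 hZK ηZ hηZ le_rfl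
  have HE := Summit.AtomisticToContinuum.HydrodynamicLimit.Theorems.HemisphereAffineSlaving.stub_energyAllTimes a₀ θ₀ u₀ hP
  refine ⟨min σF (1 / 2), lt_min hσF (by norm_num), ηZ, hηZ, ?_⟩
  intro σ hσ hlt Φ t ht γ C φ hγ hγ' hadm hDil ψ χ hψ hχ
  have hltF : σ < σF := lt_of_lt_of_le hlt (min_le_left _ _)
  have hhalf : σ ≤ 1 / 2 := (lt_of_lt_of_le hlt (min_le_right _ _)).le
  obtain ⟨E₀, -, HEt⟩ := HE σ hσ hhalf Φ
  have hFloc : ∀ δ : ℝ, 0 < δ → Tendsto (fun N : ℕ =>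
      Literature.MathematicalPhysics.KineticTheory.localGibbsLaw σ a₀ u₀ θ₀ N (Φ N)
        {z | δ < ∫ s in Icc 0 t, ∫ x, ((∑ j, ∑ k, Dst φ N ((Φ N).flow s z) x j k ^ 2) +
          ‖qfl φ N ((Φ N).flow s z) x‖ ^ 2)}) atTop (𝓝 0) :=
    fun δ hδ => HF σ hσ hltF Φ γ C φ hγ hγ' hadm t ht δ hδ
  exact HC σ hσ a₀ θ₀ u₀ Φ t E₀ ht (HEt t) γ C φ hγ hγ' hadm hDil hFloc ψ χ hψ hχ

/-! ## The glue theorem of the split -/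

/-- **THE CRUX FROM ITS FIVE CHILDREN.** `CollisionMomentBound` (stmt-15144, by name) → [Kσ] `CollisionalStressLawInline` → [Kq]
`CollisionalEnergyFluxLawInline` → [S'] `MesoscaleDiluteCeilingAllTimesInline` → [KC] `WeightedKineticCorrectionsVanishInline` →
`StiffCollisionalRelaxation.CollisionalTransferLocality` (the filed `∀ t > 0` crux BY NAME). Proof: the composition of
`collisionalTransferLocality_of_laws` with the kinetic input taken from child 5 instead of 9522 + [C]°: [Z] supplies `(η_Z, K)`,
15144 the virial tightness [V], [Kσ]/[Kq] their dilute levels `η_ψ, η_χ`, [KC] its level `η_K`; [S'] is invoked at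
`η⋆ := min (min η_Z η_K) (min η_ψ η_χ)` and `DiluteAt.mono` raises the level; `σ₀ := min (min σ_V σ_K) (min (min σ_ψ σ_χ) (min σ_S (1/2)))`;
then `conclusion_of_channels` ([S1] balance identity + marked reduction + channel additivity [G2], landed) closes the crux's
conclusion, which is `ConclusionAtFlow` definitionally (`conclusionAtFlow_iff`). -/
theorem collisionalTransferLocality_of_subs
    (hM : Summit.AtomisticToContinuum.HydrodynamicLimit.Theses.InformationPercolationEngine.CollisionMomentBound)
    (hKσ : CollisionalStressLawInline) (hKq : CollisionalEnergyFluxLawInline)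
    (hS : MesoscaleDiluteCeilingAllTimesInline) (hKC : WeightedKineticCorrectionsVanishInline) :
    Summit.AtomisticToContinuum.HydrodynamicLimit.Theses.StiffCollisionalRelaxation.CollisionalTransferLocality := by
  have hKσ' : CollisionalStressLaw := collisionalStressLaw_iff_inline.1 hKσ
  have hKq' : CollisionalEnergyFluxLaw := collisionalEnergyFluxLaw_iff_inline.1 hKq
  have hS' := ceilingAllTimes_of_inline hS
  have hKC' := relaxC_of_inline hKC
  intro a₀ θ₀ u₀ ha hθ hu ha0 hθ0
  have hP : NiceProfiles a₀ θ₀ u₀ := ⟨ha, hθ, hu, ha0, hθ0⟩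
  obtain ⟨ηZ, hηZ, K, hK0, hZK⟩ :=
    Summit.AtomisticToContinuum.HydrodynamicLimit.Theorems.HemisphereAffineSlaving.stub_hsCompressibility_linear
  obtain ⟨σV, hσV, HV⟩ := virialBounded_of_collisionMomentBound hM a₀ θ₀ u₀ hP
  obtain ⟨σBψ, hσBψ, ηψ, hηψ, HBψ⟩ := hKσ' a₀ θ₀ u₀ hP
  obtain ⟨σBχ, hσBχ, ηχ, hηχ, HBχ⟩ := hKq' a₀ θ₀ u₀ hP
  obtain ⟨σK, hσK, ηK, hηK, HK⟩ := hKC' a₀ θ₀ u₀ hP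
  set ηs : ℝ := min (min ηZ ηK) (min ηψ ηχ) with hηs
  have hηs0 : 0 < ηs := lt_min (lt_min hηZ hηK) (lt_min hηψ hηχ)
  have hηsZ : ηs ≤ ηZ := (min_le_left _ _).trans (min_le_left _ _)
  have hηsK : ηs ≤ ηK := (min_le_left _ _).trans (min_le_right _ _)
  have hηsψ : ηs ≤ ηψ := (min_le_right _ _).trans (min_le_left _ _)
  have hηsχ : ηs ≤ ηχ := (min_le_right _ _).trans (min_le_right _ _)
  obtain ⟨σS, hσS, HS⟩ := hS' ηs hηs0 a₀ θ₀ u₀ hP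
  refine ⟨min (min σV σK) (min (min σBψ σBχ) (min σS (1 / 2))), ?_, ?_⟩
  · exact lt_min (lt_min hσV hσK) (lt_min (lt_min hσBψ hσBχ) (lt_min hσS (by norm_num)))
  intro σ hσ hlt
  have hltV : σ < σV := lt_of_lt_of_le hlt ((min_le_left _ _).trans (min_le_left _ _))
  have hltK : σ < σK := lt_of_lt_of_le hlt ((min_le_left _ _).trans (min_le_right _ _))
  have hltBψ : σ < σBψ := lt_of_lt_of_le hlt
    ((min_le_right _ _).trans ((min_le_left _ _).trans (min_le_left _ _)))
  have hltBχ : σ < σBχ := lt_of_lt_of_le hlt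
    ((min_le_right _ _).trans ((min_le_left _ _).trans (min_le_right _ _)))
  have hltS : σ < σS := lt_of_lt_of_le hlt
    ((min_le_right _ _).trans ((min_le_right _ _).trans (min_le_left _ _)))
  have hhalf : σ ≤ 1 / 2 :=
    (lt_of_lt_of_le hlt ((min_le_right _ _).trans ((min_le_right _ _).trans (min_le_right _ _)))).le
  intro Φ
  show ConclusionAtFlow σ a₀ θ₀ u₀ Φ
  rw [conclusionAtFlow_iff]
  intro γ C φ hγ hγ' hadm t ht ψ χ hψ hχ
  have hDil : DiluteAt σ a₀ θ₀ u₀ Φ t φ ηs := HS σ hσ hltS Φ t ht γ C φ hγ hγ' hadm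
  have hVir : VirialBounded σ a₀ θ₀ u₀ Φ t := HV σ hσ hltV Φ t ht
  have hφc : ∀ N, Continuous (φ N) := fun N => (hadm.1 N).continuous
  have hφ0 : ∀ N y, 0 ≤ φ N y := hadm.2.1
  have h0χ := isSmoothSpaceTimeOn_zero_scalar (Icc 0 t)
  have h0ψ := isSmoothSpaceTimeOn_zero_vector (Icc 0 t)
  exact conclusion_of_channels hσ hhalf hηZ hK0 hZK hηs0 hηsZ a₀ θ₀ u₀ Φ φ ht hφc hφ0 hDil hψ hχ hVir
    (HBψ σ hσ hltBψ Φ t ht hVir γ C φ hγ hγ' hadm (hDil.mono hηsψ) ψ hψ)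
    (HBχ σ hσ hltBχ Φ t ht hVir γ C φ hγ hγ' hadm (hDil.mono hηsχ) χ hχ)
    (HK σ hσ hltK Φ t ht γ C φ hγ hγ' hadm (hDil.mono hηsK) ψ _ hψ h0χ)
    (HK σ hσ hltK Φ t ht γ C φ hγ hγ' hadm (hDil.mono hηsK) _ χ h0ψ hχ)

/-- The CIC copy (the two route decls are `rfl`-equal, `Disproof.shared_verbatim`). -/
theorem collisionalTransferLocality_of_subs_cic
    (hM : Summit.AtomisticToContinuum.HydrodynamicLimit.Theses.InformationPercolationEngine.CollisionMomentBound)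
    (hKσ : CollisionalStressLawInline) (hKq : CollisionalEnergyFluxLawInline)
    (hS : MesoscaleDiluteCeilingAllTimesInline) (hKC : WeightedKineticCorrectionsVanishInline) :
    Summit.AtomisticToContinuum.HydrodynamicLimit.Theses.CollisionIsometryCLT.CollisionalTransferLocality :=
  collisionalTransferLocality_of_subs hM hKσ hKq hS hKC

end Split

end

end Summit.AtomisticToContinuum.HydrodynamicLimit.Theorems.HemisphereAffineSlaving
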